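import Summits.QuantumFields.BalabanUV.Beta.GAN24.TripleFaceCharge
import Summits.QuantumFields.BalabanUV.Beta.GAN24.Push3Nest

/-!
# `BalabanUV.Beta.GAN24.GaugeReadTransport` — binder row G-an2-4 ∕ (CONV-C), W-slot CT-W, route «WC-TL» ∕ (Q-R) «QR-LL», rows (LT) ∕ (DIV) ∕ (DL):
# **THE GAUGE READ-OUT COMMUTES WITH THE DRESSED TRANSPORT** — PART 3 of leaf-03 g64's «TRIPLE WARD READ-OUT» (replacing the withdrawn «nested» PART 3,
# journal W-4): for ANY leg family `w` obeying a coarse Ward law `Σ_λ (w λ (x − e_λ) κ u − w λ x κ u) = c·gaugeWt N x κ u` (blocking `N`) and the block-indicator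
# gauge leg `Γ_{L′}` of the NEXT lattice, **`legComp w Γ_{L′} = c • Γ_{N·L′}`** EXACTLY; hence (`Push3Nest.push₃_push₃`) the gauge-weight push of a pushed letter is
# `c_l c_r c_w ×` the gauge-weight push of the letter at the composite blocking, and in the END's units THE TRIPLE FACE CHARGE IS A TRANSPORT INVARIANT:
# `push₃ Γ_{L′} Γ Γ (transport unitStepMap m (j+1) S) = push₃ Γ_{Lc^{j+1}·L′} Γ Γ S` — the dressed transport neither damps nor amplifies nor CREATES triple face charge
# (G-an2-4 formalisation swarm → CRUX TEAM (2), leaf prover `b2b-balaban-gan24-formalise-leaf-03`, gen 64, PART 3′; the invariance was stated FIRST by the row OWNER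
# `b2b-balaban-gan24-p1` g32, W6 journal l.48401, in `legAct` form over leaf-01 g57's `RespStepBmDecompExact.legAct_legChain_dz` — typed here, reached independently
# from PART 2 §1 in `legComp` form, W-4 l.48449; the OWNER files nothing on it, W8 l.48497)

NOT IN PRINT; OUR BOOKKEEPING ([folklore] PART 2 `TripleFaceCharge.tsum_gaugeWt_mul_eq` BY NAME; leaf-01's `Push4.legComp_apply`, `Push3Nest.push₃_push₃`, `Push3.push₃_smul`,
`Push3LegTelescope.push₃_smul_left ∕ _right ∕ _table`; `SrecBornSector.transport_unitStepMap_succ_eq_push₃`; `AveragingContours.blk_block ∕ blk_add_off ∕ off_mem_box`,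
`WardRemainderEndThreeSplit.l1_toSite_le`, `Int.ediv_ediv_of_nonneg`; generic `d`; 0 `def`, 0 cited facts, 0 `def … : Prop`, 0 sorry).  HONEST FRAMING (cell contract, verbatim):
«discharging `BetaPertH` makes Bałaban's UV stability UNCONDITIONAL — a real constructive-QFT result; it is NOT the continuum limit and NOT the Clay problem.»  HONEST DEPENDENCY
(verbatim): «continuum YM on T⁴ ⇐ BetaPertH ∧ nine spine estimates (0/9 proved); BetaPertH ⇐ (D1) ∧ (D4) ∧ CAP+tail; G-an2-4 gates asym, D1 and NE2/3/4.»

## Why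
PART 1 read the three dressed legs of ONE transport out of the letter; iterating suggested (the withdrawn PART 3) that the END's `hLT` would constrain the triple face charge
of every PARTIAL transport separately.  It does not say more: a Ward-covariant leg followed by a gauge read IS a gauge read at the composite blocking, times `c` (§1) —
the block-constant gauge mode passes each dressed leg with weight `c = N^{−(d+1)}` EXACTLY (leaf-01 `DressedLegSeamLowerBound`, the OWNER g32's
`DressedCubicPushNoContraction`), and that is precisely what makes the read-out commute.  Consequences recorded here: (i) the END's normalisation makes the triple face charge
an INVARIANT of the dressed transport (§3) — the content of the (DIV)∕(DL) count's «undamped mode», for every letter, as an identity; (ii) the withdrawn PART 3's bound at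
split `(j, i)` is PART 2's bound at depth `j+i` on THE SAME NUMBER (§3's corollary); (iii) for the OWNER's engine E41 the born letters at the composite blockings suffice
(two-push objects add nothing to the triple read), and a letter in leaf-01 g70's null channel (the born Wilson span) has triple-face-charge-free transports at EVERY depth —
so if the literal's non-Wilson born components also read zero, PART 2's criterion is void for the literal and the (DL) count lives in the MIXED modes (PART 1's single and
double read-outs, legs left in).  Identities only; decides nothing about (Q-R) ∕ (LT) for the literal.

## What
* §1 `blk_blk` (nested blockings), `sum_box_ite_eq` (one block point per coarse site), **`finsetSum_gaugeWt_block_eq`** (`Σ_{b ∈ box L′} gaugeWt N (L′•Y + toSite b) κ u = gaugeWt (N·L′) Y κ u`),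
  `summable_gaugeWt_mul`, `legDecay_gaugeWt` (the gauge leg is in leaf-01's `LegDecay` class at rate `1`), **`legComp_gaugeWt_apply_eq_of_ward`** ∕ **`legComp_gaugeWt_eq_smul_of_ward`**:
  `legComp w Γ_{L′} = c • Γ_{N·L′}` under the displayed Ward law of `w`.
* §2 **`push₃_gaugeWt_push₃_eq_smul`**: legs `l r w` `LegDecay` at blocking `N` (positive rate) with Ward laws `(c_l, c_r, c_w)`, `LocStencil S Cs δ` (`δ > 0`), `1 ≤ L′`:
  `push₃ Γ_{L′} Γ_{L′} Γ_{L′} (push₃ l r w S) κ′ u′ = (c_l·(c_r·c_w)) • push₃ Γ_{N·L′} Γ Γ S κ′ u′`.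
* §4 **`pow_mul_abs_push₃_slotGauge_le_of_biLoc`** — THE PARTIAL (slot) READ-OUT: the END-shape bound on `L^{3(d+1)}·push₃ T T T S` gives
  `L^{2(d+1)}·|push₃ T T Γ S κ₀ U x z a b| ≤ 2(d+1)·E₀` — the BLOCK-FLUX letter on the two dressed KERNEL legs (FLUX-REC's sandwich) in two-leg units; no invariance there.
* §3 **`push₃_gaugeWt_transport_succ_eq`** (in-block root; `S` ff-valued, `LocStencil` at a positive rate; the END's unit `cE = Lc^{d+1}`):
  `push₃ Γ_{L′}³ (transport (unitStepMap Lc (toSite rr) (Lc^{d+1})) m (j+1) S) κ₀ U = push₃ Γ_{Lc^{j+1}·L′}³ S κ₀ U` — THE TRIPLE FACE CHARGE IS A TRANSPORT INVARIANT;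
  **`push₃_gaugeWt_transport_succ_eq_pow`** (`L′ = Lc^{i+1}`: the withdrawn PART 3's object IS PART 2's at depth `j+i+1`).
Identities only: NO size asserted; NOTHING of (LT) ∕ (LAY) ∕ (S) ∕ (DIV) ∕ (DL) ∕ «T2Shape» discharged or refuted; NEVER «G-an2-4 closed» as (CONV-C); NOT D1, NOT `BetaPertH`, NOT continuum,
NOT Clay; not in print — our bookkeeping.  2026-08-23; no existing file touched.
-/

noncomputable section

open Finset
open scoped BigOperators
open Literature.MathematicalPhysics.QuantumFieldTheory
open Literature.MathematicalPhysics.QuantumFieldTheory.Balaban1983to89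
open Literature.MathematicalPhysics.QuantumFieldTheory.Balaban1983to89.Beta
open B12Sec2to5 (l1 l1_nonneg)
open ExpKernelCalculus (MKer Decays BiLoc l1_sub_triangle)
open AffineAveraging (box toSite)
open AveragingContours (blk)
open OneStepResolventKernel (Fib LocStencil)
open Summit.QuantumFields.BalabanUV.Beta.KernelWardRelative (gaugeWt)
open Summit.QuantumFields.BalabanUV.Beta.GAN24.Push4 (legComp legComp_apply IsFF)
open Summit.QuantumFields.BalabanUV.Beta.GAN24.Push4Bounds (LegDecay LegDecay.abs_le LegDecay.summable)
open Summit.QuantumFields.BalabanUV.Beta.GAN24.Push4Iter (legChain legDecay_legChain)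
open Summit.QuantumFields.BalabanUV.Beta.GAN24.Push3 (push₃ push₃_smul)
open Summit.QuantumFields.BalabanUV.Beta.GAN24.Push3LegTelescope (push₃_smul_left push₃_smul_right push₃_smul_table)
open Summit.QuantumFields.BalabanUV.Beta.GAN24.Push3Nest (push₃_push₃)
open Summit.QuantumFields.BalabanUV.Beta.GAN24.RespStepBmDecompExact (respStepBmSeq)
open Summit.QuantumFields.BalabanUV.Beta.GAN24.SrecBornSector (unitStepMap transport_unitStepMap_succ_eq_push₃)
open Summit.QuantumFields.BalabanUV.Beta.GAN24.SrecWilsonSector (legDecay_respStepBmSeq)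
open Summit.QuantumFields.BalabanUV.Beta.GAN24.AffineUnroll (transport)
open Summit.QuantumFields.BalabanUV.Beta.GAN24.PushRowCoarseWardChain (sum_legChain_sub_eq_gaugeWt)
open Summit.QuantumFields.BalabanUV.Beta.GAN24.WardRemainderEndThreeSplit (l1_toSite_le)
open Summit.QuantumFields.BalabanUV.Beta.GAN24.TripleFaceCharge (tsum_gaugeWt_mul_eq)

namespace Summit.QuantumFields.BalabanUV.Beta.GAN24.GaugeReadTransport

variable {d : ℕ}

/-! ## §1 A Ward-covariant leg followed by a gauge read is a gauge read at the composite blocking -/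

section Blocks

variable {N L : ℕ}

/-- [folklore] **NESTED BLOCKINGS**: `blk L (blk N u) = blk (N·L) u` (`Int.ediv_ediv_of_nonneg`). -/
theorem blk_blk (N L : ℕ) (u : Fin (d + 1) → ℤ) : blk L (blk N u) = blk (N * L) u := by
  funext i
  simp only [AveragingContours.blk, Nat.cast_mul]
  exact Int.ediv_ediv_of_nonneg (Int.natCast_nonneg N)

open Classical in
/-- [folklore] **ONE BLOCK POINT PER COARSE SITE**: `Σ_{b ∈ box L} [z = L•Y + toSite b] = [blk L z = Y]` (`1 ≤ L`; `blk_block`, `blk_add_off`, `AxialProjector.toSite_injective`). -/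
theorem sum_box_ite_eq (hL : 1 ≤ L) (Y z : Fin (d + 1) → ℤ) (a : ℝ) :
    (∑ b ∈ box (d + 1) L, if z = (L : ℤ) • Y + toSite b then a else 0) = if blk L z = Y then a else 0 := by
  by_cases h : blk L z = Y
  · rw [if_pos h]
    have hz : z = (L : ℤ) • Y + toSite (AveragingContours.off L z) := by rw [← h, AveragingContours.blk_add_off hL z]
    rw [Finset.sum_eq_single_of_mem (AveragingContours.off L z) (AveragingContours.off_mem_box hL z) (fun b _ hb => ?_)]
    · rw [if_pos hz]
    · rw [if_neg]
      intro hzb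
      apply hb
      have : toSite b = toSite (AveragingContours.off L z) := add_left_cancel (hzb.symm.trans hz)
      exact AxialProjector.toSite_injective this
  · rw [if_neg h]
    refine Finset.sum_eq_zero fun b hb => ?_
    rw [if_neg]
    intro hzb
    exact h (by rw [hzb]; exact AveragingContours.blk_block Y hb)

open Classical in
/-- NOT IN PRINT; OUR BOOKKEEPING.  **THE BLOCK SUM OF THE FINE GAUGE WEIGHTS IS THE COMPOSITE GAUGE WEIGHT**: `Σ_{b ∈ box L} gaugeWt N (L•Y + toSite b) κ u = gaugeWt (N·L) Y κ u`
(`1 ≤ L`): the indicators of the `N`-blocks under the `L`-block of `Y` add up to the indicator of the `N·L`-block of `Y`. -/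
theorem finsetSum_gaugeWt_block_eq (hL : 1 ≤ L) (N : ℕ) (Y : Fin (d + 1) → ℤ) (κ : Fin (d + 1)) (u : Fin (d + 1) → ℤ) :
    ∑ b ∈ box (d + 1) L, gaugeWt N ((L : ℤ) • Y + toSite b) κ u = gaugeWt (N * L) Y κ u := by
  simp only [KernelWardRelative.gaugeWt, Finset.sum_sub_distrib]
  have e1 : ∀ z : Fin (d + 1) → ℤ, (∑ b ∈ box (d + 1) L, if z = (L : ℤ) • Y + toSite b then (1 : ℝ) else 0) = if blk L z = Y then 1 else 0 :=
    fun z => sum_box_ite_eq hL Y z 1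
  have e2 : ∀ z : Fin (d + 1) → ℤ, (∑ b ∈ box (d + 1) L, if blk N z = (L : ℤ) • Y + toSite b then (1 : ℝ) else 0) = if blk (N * L) z = Y then 1 else 0 := by
    intro z; rw [e1 (blk N z), blk_blk]
  rw [e2, e2]

open Classical in
/-- [folklore] `v ↦ gaugeWt L Y λ v · f v` has finite support (the bonds crossing `∂B_L(Y)`), hence is summable. -/
theorem summable_gaugeWt_mul (hL : 1 ≤ L) (Y : Fin (d + 1) → ℤ) (lam : Fin (d + 1)) (f : (Fin (d + 1) → ℤ) → ℝ) :
    Summable fun v => gaugeWt L Y lam v * f v := by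
  refine summable_of_ne_finset_zero
    (s := (box (d + 1) L).image (fun b => (L : ℤ) • Y + toSite b) ∪ (box (d + 1) L).image (fun b => (L : ℤ) • Y + toSite b - AffineAveraging.unitVec lam))
    (fun v hv => ?_)
  rw [Finset.mem_union, not_or] at hv
  have h1 : blk L v ≠ Y := fun hb => hv.1 (Finset.mem_image.2
    ⟨AveragingContours.off L v, AveragingContours.off_mem_box hL v, by rw [← hb, AveragingContours.blk_add_off hL v]⟩)
  have h2 : blk L (v + AffineAveraging.unitVec lam) ≠ Y := fun hb => hv.2 (Finset.mem_image.2
    ⟨AveragingContours.off L (v + AffineAveraging.unitVec lam), AveragingContours.off_mem_box hL _, by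
      rw [← hb, AveragingContours.blk_add_off hL, add_sub_cancel_right]⟩)
  simp only [KernelWardRelative.gaugeWt, AveragingWardStencils.b6UnitVec_eq, if_neg h1, if_neg h2, sub_zero, zero_mul]

/-- [folklore] **THE GAUGE LEG IS IN THE `LegDecay` CLASS** at its own blocking, rate `1`, constant `e^{(d+1)L+1}` (it lives on the bonds crossing `∂B_L(Y)`, all within
`‖v − L•Y‖₁ ≤ (d+1)L + 1`). -/
theorem legDecay_gaugeWt (hL : 1 ≤ L) : LegDecay (fun (_ : Fin (d + 1)) => gaugeWt (d := d) L) L (Real.exp (((d : ℝ) + 1) * L + 1)) 1 := by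
  intro μ Y lam v
  show |gaugeWt L Y lam v| ≤ Real.exp (((d : ℝ) + 1) * L + 1) * Real.exp (-1 * l1 (v - (L : ℤ) • Y))
  by_cases h0 : gaugeWt L Y lam v = 0
  · rw [h0, abs_zero]; positivity
  · -- a bond crossing the boundary: one endpoint lies in the block
    have hle : |gaugeWt L Y lam v| ≤ 1 := DressedLegSeamLowerBound.abs_gaugeWt_le_one L Y lam v
    have hdist : l1 (v - (L : ℤ) • Y) ≤ ((d : ℝ) + 1) * L + 1 := by
      by_cases hv : blk L v = Y
      · have e : v - (L : ℤ) • Y = toSite (AveragingContours.off L v) := by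
          rw [sub_eq_iff_eq_add', ← hv, AveragingContours.blk_add_off hL v]
        rw [e]
        linarith [l1_toSite_le (AveragingContours.off_mem_box hL v)]
      · have hv' : blk L (v + AffineAveraging.unitVec lam) = Y := by
          by_contra hv'
          apply h0
          simp only [KernelWardRelative.gaugeWt, AveragingWardStencils.b6UnitVec_eq, if_neg hv, if_neg hv', sub_zero]
        have e : v + AffineAveraging.unitVec lam - (L : ℤ) • Y = toSite (AveragingContours.off L (v + AffineAveraging.unitVec lam)) := by
          rw [sub_eq_iff_eq_add', ← hv', AveragingContours.blk_add_off hL]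
        have h1 : l1 (v + AffineAveraging.unitVec lam - (L : ℤ) • Y) ≤ ((d : ℝ) + 1) * L := by
          rw [e]; exact l1_toSite_le (AveragingContours.off_mem_box hL _)
        have h2 : l1 (v - (L : ℤ) • Y) ≤ l1 (v + AffineAveraging.unitVec lam - (L : ℤ) • Y) + l1 (AffineAveraging.unitVec (d := d + 1) lam) := by
          have h := l1_sub_triangle v (v + AffineAveraging.unitVec lam) ((L : ℤ) • Y)
          have e3 : l1 (v - (v + AffineAveraging.unitVec lam)) = l1 (AffineAveraging.unitVec (d := d + 1) lam) := by
            rw [ExpKernelCalculus.l1_sub_symm, add_sub_cancel_left]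
          linarith [e3]
        have h3 : l1 (AffineAveraging.unitVec (d := d + 1) lam) = 1 := by
          rw [← AveragingWardStencils.b6UnitVec_eq]; exact StepJetData.l1_unitVec lam
        linarith
    calc |gaugeWt L Y lam v| ≤ 1 := hle
      _ = Real.exp (((d : ℝ) + 1) * L + 1) * Real.exp (-(((d : ℝ) + 1) * L + 1)) := by rw [← Real.exp_add, add_neg_cancel, Real.exp_zero]
      _ ≤ Real.exp (((d : ℝ) + 1) * L + 1) * Real.exp (-1 * l1 (v - (L : ℤ) • Y)) :=
          mul_le_mul_of_nonneg_left (Real.exp_le_exp.2 (by linarith)) (Real.exp_pos _).le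

variable {w : Fin (d + 1) → (Fin (d + 1) → ℤ) → Fin (d + 1) → (Fin (d + 1) → ℤ) → ℝ}

/-- NOT IN PRINT; OUR BOOKKEEPING.  **A WARD-COVARIANT LEG FOLLOWED BY A GAUGE READ IS A GAUGE READ AT THE COMPOSITE BLOCKING, TIMES `c`** (entrywise): if
`Σ_λ (w λ (x − e_λ) κ u − w λ x κ u) = c·gaugeWt N x κ u` for all `x κ u`, then for `1 ≤ L`, every `μ Y κ u`,
`legComp w (fun _ ↦ gaugeWt L) μ Y κ u = c·gaugeWt (N·L) Y κ u` (PART 2's `tsum_gaugeWt_mul_eq` ⨾ the Ward law at the `L`-block's points ⨾ `finsetSum_gaugeWt_block_eq`). -/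
theorem legComp_gaugeWt_apply_eq_of_ward (hL : 1 ≤ L) {c : ℝ}
    (hW : ∀ x κ u, ∑ lam, (w lam (x - AffineAveraging.unitVec lam) κ u - w lam x κ u) = c * gaugeWt N x κ u)
    (μ : Fin (d + 1)) (Y : Fin (d + 1) → ℤ) (κ : Fin (d + 1)) (u : Fin (d + 1) → ℤ) :
    legComp w (fun _ => gaugeWt L) μ Y κ u = c * gaugeWt (N * L) Y κ u := by
  rw [legComp_apply]
  rw [Summable.tsum_finsetSum (fun lam _ => summable_gaugeWt_mul hL Y lam (fun v => w lam v κ u))]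
  have e : ∀ lam, ∑' v, gaugeWt L Y lam v * w lam v κ u
      = ∑ b ∈ box (d + 1) L, (w lam ((L : ℤ) • Y + toSite b - AffineAveraging.unitVec lam) κ u - w lam ((L : ℤ) • Y + toSite b) κ u) :=
    fun lam => tsum_gaugeWt_mul_eq hL Y lam (fun v => w lam v κ u)
  rw [Finset.sum_congr rfl (fun lam _ => e lam), Finset.sum_comm,
    Finset.sum_congr rfl (fun b _ => hW ((L : ℤ) • Y + toSite b) κ u), ← Finset.mul_sum, finsetSum_gaugeWt_block_eq hL N Y κ u]

/-- NOT IN PRINT; OUR BOOKKEEPING.  **`legComp w Γ_L = c • Γ_{N·L}`** as leg families. -/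
theorem legComp_gaugeWt_eq_smul_of_ward (hL : 1 ≤ L) {c : ℝ}
    (hW : ∀ x κ u, ∑ lam, (w lam (x - AffineAveraging.unitVec lam) κ u - w lam x κ u) = c * gaugeWt N x κ u) :
    legComp w (fun (_ : Fin (d + 1)) => gaugeWt L) = c • (fun (_ : Fin (d + 1)) => gaugeWt (d := d) (N * L)) := by
  funext μ Y κ u
  rw [legComp_gaugeWt_apply_eq_of_ward hL hW μ Y κ u, Pi.smul_apply, Pi.smul_apply, Pi.smul_apply, Pi.smul_apply, smul_eq_mul]

end Blocks

/-! ## §2 The gauge-weight push of a pushed letter -/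

section Pushed

variable {l r w : Fin (d + 1) → (Fin (d + 1) → ℤ) → Fin (d + 1) → (Fin (d + 1) → ℤ) → ℝ}
  {S : Fin (d + 1) → (Fin (d + 1) → ℤ) → MKer (d + 1) (Fib d)} {N L : ℕ} {Cl Cr Cw ml Cs δ cl cr cw : ℝ}

/-- NOT IN PRINT; OUR BOOKKEEPING.  **THE GAUGE-WEIGHT PUSH OF A PUSHED LETTER IS THE GAUGE-WEIGHT PUSH OF THE LETTER AT THE COMPOSITE BLOCKING, TIMES THE THREE WARD
CONSTANTS**: legs `l r w` in leaf-01's `LegDecay` class at blocking `N` (rate `ml > 0`) with coarse Ward laws `(c_l, c_r, c_w)`, `LocStencil S Cs δ` (`δ > 0`), `1 ≤ L` ⟹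
`push₃ Γ_L Γ_L Γ_L (push₃ l r w S) κ′ u′ = (c_l·(c_r·c_w)) • push₃ Γ_{N·L} Γ_{N·L} Γ_{N·L} S κ′ u′` (`Push3Nest.push₃_push₃` ⨾ §1 on each leg ⨾ homogeneity). -/
theorem push₃_gaugeWt_push₃_eq_smul (hl : LegDecay l N Cl ml) (hr : LegDecay r N Cr ml) (hw : LegDecay w N Cw ml) (hml : 0 < ml)
    (hS : LocStencil S Cs δ) (hδ : 0 < δ) (hL : 1 ≤ L)
    (hWl : ∀ x κ u, ∑ lam, (l lam (x - AffineAveraging.unitVec lam) κ u - l lam x κ u) = cl * gaugeWt N x κ u)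
    (hWr : ∀ x κ u, ∑ lam, (r lam (x - AffineAveraging.unitVec lam) κ u - r lam x κ u) = cr * gaugeWt N x κ u)
    (hWw : ∀ x κ u, ∑ lam, (w lam (x - AffineAveraging.unitVec lam) κ u - w lam x κ u) = cw * gaugeWt N x κ u)
    (κ' : Fin (d + 1)) (u' : Fin (d + 1) → ℤ) :
    push₃ (fun _ => gaugeWt L) (fun _ => gaugeWt L) (fun _ => gaugeWt L) (push₃ l r w S) κ' u'
      = (cl * (cr * cw)) • push₃ (fun _ => gaugeWt (N * L)) (fun _ => gaugeWt (N * L)) (fun _ => gaugeWt (N * L)) S κ' u' := by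
  have hG := legDecay_gaugeWt (d := d) hL
  rw [push₃_push₃ hG hG hG hl hr hw one_pos hml hS hδ κ' u', legComp_gaugeWt_eq_smul_of_ward hL hWl,
    legComp_gaugeWt_eq_smul_of_ward hL hWr, legComp_gaugeWt_eq_smul_of_ward hL hWw, push₃_smul_left, push₃_smul_right, push₃_smul_table,
    smul_smul, smul_smul, mul_assoc]

end Pushed

/-! ## §3 In the END's units: the triple face charge is a transport invariant -/

section Transport

variable {Lc : ℕ} [NeZero Lc] {rr : Fin (d + 1) → ℕ}
  {S : Fin (d + 1) → (Fin (d + 1) → ℤ) → MKer (d + 1) (Fib d)} {Cs δ : ℝ}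

/-- NOT IN PRINT; OUR BOOKKEEPING.  **THE TRIPLE FACE CHARGE IS A TRANSPORT INVARIANT IN THE END's UNITS**: for every in-block root, base level `m`, `j`, blocking `L ≥ 1`
of the transported letter's lattice, an ff-valued `LocStencil S Cs δ` (`δ > 0`) and every coarse slot `(κ₀, U)`,
`push₃ Γ_L Γ_L Γ_L (transport (unitStepMap Lc (toSite rr) (Lc^{d+1})) m (j+1) S) κ₀ U = push₃ Γ_{Lc^{j+1}·L} Γ Γ S κ₀ U`
— the unit transport over `j+1` dressed levels is `(Lc^{3(d+1)})^{j+1} •` one cubic push through the chain (`transport_unitStepMap_succ_eq_push₃`), its three Ward constants are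
`(Lc^{(d+1)(j+1)})⁻¹` each (`sum_legChain_sub_eq_gaugeWt`), and `(Lc^{3(d+1)})^{j+1}·((Lc^{(d+1)(j+1)})⁻¹)³ = 1`: the dressed transport neither damps nor amplifies nor creates
triple face charge. -/
theorem push₃_gaugeWt_transport_succ_eq (hrr : rr ∈ box (d + 1) Lc) (m j : ℕ) {L : ℕ} (hL : 1 ≤ L) (hff : ∀ κ u, IsFF (S κ u))
    (hS : LocStencil S Cs δ) (hδ : 0 < δ) (κ₀ : Fin (d + 1)) (U : Fin (d + 1) → ℤ) :
    push₃ (fun _ => gaugeWt L) (fun _ => gaugeWt L) (fun _ => gaugeWt L)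
        (transport (unitStepMap Lc (toSite rr) ((Lc : ℝ) ^ (d + 1))) m (j + 1) S) κ₀ U
      = push₃ (fun _ => gaugeWt (Lc ^ (j + 1) * L)) (fun _ => gaugeWt (Lc ^ (j + 1) * L)) (fun _ => gaugeWt (Lc ^ (j + 1) * L)) S κ₀ U := by
  have hLc : (0 : ℝ) < (Lc : ℝ) := by exact_mod_cast Nat.pos_of_ne_zero (NeZero.ne Lc)
  obtain ⟨CT, mT, hmT, hT⟩ := legDecay_legChain (fun i => legDecay_respStepBmSeq (Lc := Lc) hrr i) m j
  rw [transport_unitStepMap_succ_eq_push₃ hrr ((Lc : ℝ) ^ (d + 1)) m hff ⟨Cs, δ, hδ, hS⟩ j]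
  -- the scalar comes out of the table, then §2
  have e1 : (fun κ' u' => ((Lc : ℝ) ^ (d + 1) * (Lc : ℝ) ^ (2 * (d + 1))) ^ (j + 1) •
        push₃ (legChain (respStepBmSeq (toSite rr) Lc) m j) (legChain (respStepBmSeq (toSite rr) Lc) m j) (legChain (respStepBmSeq (toSite rr) Lc) m j) S κ' u')
      = fun κ' u' => ((Lc : ℝ) ^ (d + 1) * (Lc : ℝ) ^ (2 * (d + 1))) ^ (j + 1) •
        (push₃ (legChain (respStepBmSeq (toSite rr) Lc) m j) (legChain (respStepBmSeq (toSite rr) Lc) m j) (legChain (respStepBmSeq (toSite rr) Lc) m j) S) κ' u' := rfl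
  rw [e1, push₃_smul, push₃_gaugeWt_push₃_eq_smul hT hT hT hmT hS hδ hL
    (sum_legChain_sub_eq_gaugeWt hrr m j) (sum_legChain_sub_eq_gaugeWt hrr m j) (sum_legChain_sub_eq_gaugeWt hrr m j) κ₀ U, smul_smul]
  have hunit : ((Lc : ℝ) ^ (d + 1) * (Lc : ℝ) ^ (2 * (d + 1))) ^ (j + 1) *
      ((((Lc : ℝ) ^ ((d + 1) * (j + 1)))⁻¹) * ((((Lc : ℝ) ^ ((d + 1) * (j + 1)))⁻¹) * (((Lc : ℝ) ^ ((d + 1) * (j + 1)))⁻¹))) = 1 := by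
    have hL0 : (Lc : ℝ) ^ ((d + 1) * (j + 1)) ≠ 0 := pow_ne_zero _ hLc.ne'
    have e : ((Lc : ℝ) ^ (d + 1) * (Lc : ℝ) ^ (2 * (d + 1))) ^ (j + 1) = ((Lc : ℝ) ^ ((d + 1) * (j + 1))) ^ 3 := by
      rw [← pow_add, ← pow_mul, ← pow_mul]; congr 1; ring
    rw [e]; field_simp
  rw [hunit, one_smul]

/-- NOT IN PRINT; OUR BOOKKEEPING.  **THE WITHDRAWN «NESTED» OBJECT IS PART 2's OBJECT**: with `L = Lc^{i+1}` the previous identity reads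
`push₃ Γ_{Lc^{i+1}}³ (transport unitStepMap m (j+1) S) κ₀ U = push₃ Γ_{Lc^{j+i+2}}³ S κ₀ U` — the `(j+1)`-step transported sub-letter's triple face charge at the remaining
blocking IS the born sub-letter's at the full blocking (so `hLT`'s consequence at every split of the depth is PART 2 §4's single bound). -/
theorem push₃_gaugeWt_transport_succ_eq_pow (hrr : rr ∈ box (d + 1) Lc) (m j i : ℕ) (hff : ∀ κ u, IsFF (S κ u))
    (hS : LocStencil S Cs δ) (hδ : 0 < δ) (κ₀ : Fin (d + 1)) (U : Fin (d + 1) → ℤ) :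
    push₃ (fun _ => gaugeWt (Lc ^ (i + 1))) (fun _ => gaugeWt (Lc ^ (i + 1))) (fun _ => gaugeWt (Lc ^ (i + 1)))
        (transport (unitStepMap Lc (toSite rr) ((Lc : ℝ) ^ (d + 1))) m (j + 1) S) κ₀ U
      = push₃ (fun _ => gaugeWt (Lc ^ (j + i + 2))) (fun _ => gaugeWt (Lc ^ (j + i + 2))) (fun _ => gaugeWt (Lc ^ (j + i + 2))) S κ₀ U := by
  rw [push₃_gaugeWt_transport_succ_eq hrr m j (Nat.one_le_iff_ne_zero.2 (pow_ne_zero _ (NeZero.ne Lc))) hff hS hδ κ₀ U, ← pow_add,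
    show j + 1 + (i + 1) = j + i + 2 by ring]

end Transport

/-! ## §4 The partial read-outs: the block-flux letter on TWO dressed kernel legs, and on ONE, obey the END's rate in their own units -/

section Partial

variable {Lc : ℕ} [NeZero Lc] {rr : Fin (d + 1) → ℕ}
  {S : Fin (d + 1) → (Fin (d + 1) → ℤ) → MKer (d + 1) (Fib d)} {Cs δ : ℝ}

/-- NOT IN PRINT; OUR BOOKKEEPING.  **THE SLOT READ-OUT ALONE: THE BLOCK-FLUX LETTER ON TWO DRESSED KERNEL LEGS** (the (DIV)∕(DL) tower's own object — leaf-03 g62's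
«FLUX-REC» sandwich `T ∘ (Σ_{B_L(U)} divV S) ∘ T`, PART 2 §1 — in TWO-leg units `L^{2(d+1)}`): for every in-block root, `m`, `k`, `LocStencil S Cs δ` (`δ > 0`), profile
`E ν U ≤ E₀`, rate `r ≥ 0`, `T = legChain (respStepBmSeq (toSite rr) Lc) m k`, `L = Lc^{k+1}`, `Γ = fun _ ↦ gaugeWt L`:
`(∀ ν U, BiLoc ((L^{3(d+1)}) • push₃ T T T S ν U) U U (E ν U) r) ⟹ L^{2(d+1)}·|push₃ T T Γ S κ₀ U x z a b| ≤ 2(d+1)·E₀` for every slot block `U` and entry —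
the transported sub-letter's bound in the END's shape is, up to `2(d+1)`, a bound of the same rate on its block flux carried by the two kernel legs (PART 1 §2 ⨾ PART 2 §2;
`L^{3(d+1)}·c = L^{2(d+1)}`).  No invariance here: the two dressed kernel legs remain, and THIS is where the (DL) count's `Lc` per leg per level lives. -/
theorem pow_mul_abs_push₃_slotGauge_le_of_biLoc (hrr : rr ∈ box (d + 1) Lc) (m k : ℕ) (hS : LocStencil S Cs δ) (hδ : 0 < δ)
    {E : Fin (d + 1) → (Fin (d + 1) → ℤ) → ℝ} {E₀ r : ℝ} (hr : 0 ≤ r) (hE : ∀ ν U, E ν U ≤ E₀)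
    (hB : ∀ ν U, BiLoc (((((Lc ^ (k + 1) : ℕ) : ℝ)) ^ (3 * (d + 1))) •
      push₃ (legChain (respStepBmSeq (toSite rr) Lc) m k) (legChain (respStepBmSeq (toSite rr) Lc) m k) (legChain (respStepBmSeq (toSite rr) Lc) m k) S ν U)
      U U (E ν U) r)
    (κ₀ : Fin (d + 1)) (U x z : Fin (d + 1) → ℤ) (a b : Fib d) :
    ((((Lc ^ (k + 1) : ℕ) : ℝ)) ^ (2 * (d + 1))) *
        |push₃ (legChain (respStepBmSeq (toSite rr) Lc) m k) (legChain (respStepBmSeq (toSite rr) Lc) m k) (fun _ => gaugeWt (Lc ^ (k + 1))) S κ₀ U x z a b|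
      ≤ 2 * ((d : ℝ) + 1) * E₀ := by
  set A : ℝ := (((Lc ^ (k + 1) : ℕ) : ℝ)) ^ (3 * (d + 1)) with hA
  set T := legChain (respStepBmSeq (toSite rr) Lc) m k with hT
  have hLc : (0 : ℝ) < (Lc : ℝ) := by exact_mod_cast Nat.pos_of_ne_zero (NeZero.ne Lc)
  have hL1 : (0 : ℝ) < (((Lc ^ (k + 1) : ℕ) : ℝ)) := by exact_mod_cast pow_pos (Nat.pos_of_ne_zero (NeZero.ne Lc)) (k + 1)
  have hApos : 0 < A := by rw [hA]; exact pow_pos hL1 _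
  -- every entry of the transported letter is `≤ E₀ ∕ A`
  have hM : ∀ ν U' x z' a b, |push₃ T T T S ν U' x z' a b| ≤ E₀ / A := by
    intro ν U' x z' a b
    have h := hB ν U' x z' a b
    rw [Pi.smul_apply, Pi.smul_apply, Pi.smul_apply, Pi.smul_apply, smul_eq_mul, abs_mul, abs_of_pos hApos] at h
    have hexp : Real.exp (-r * (l1 (x - U') + l1 (z' - U'))) ≤ 1 :=
      Real.exp_le_one_iff.2 (by nlinarith [l1_nonneg (x - U'), l1_nonneg (z' - U')])
    have hE0 : 0 ≤ E ν U' := by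
      have h0 : 0 ≤ E ν U' * Real.exp (-r * (l1 (x - U') + l1 (z' - U'))) := le_trans (by positivity) h
      exact nonneg_of_mul_nonneg_left (by rwa [mul_comm] at h0) (Real.exp_pos _)
    rw [le_div_iff₀ hApos, mul_comm]
    calc A * |push₃ T T T S ν U' x z' a b| ≤ E ν U' * Real.exp (-r * (l1 (x - U') + l1 (z' - U'))) := h
      _ ≤ E ν U' * 1 := mul_le_mul_of_nonneg_left hexp hE0
      _ ≤ E₀ := by rw [mul_one]; exact hE ν U'
  obtain ⟨CT, mT, hmT, hTd⟩ := TripleWardReadout.exists_legDecay_legChain hrr m k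
  -- the slot read-out: `divV (push₃ T T T S) U = c • push₃ T T Γ S κ₀ U`
  have hdiv := TripleWardReadout.divV_push₃_eq_smul_of_ward (fun α x' κ x => hTd.abs_le hmT.le α x' κ x) (fun α x' κ => hTd.summable hmT α x' κ)
    (fun β z' κ => hTd.summable hmT β z' κ) (fun κ' u' κ u => hTd.abs_le hmT.le κ' u' κ u) hS hδ (gaugeWt (Lc ^ (k + 1))) _
    (sum_legChain_sub_eq_gaugeWt hrr m k) κ₀ U
  have hent : |(((Lc : ℝ) ^ ((d + 1) * (k + 1)))⁻¹) * push₃ T T (fun _ => gaugeWt (Lc ^ (k + 1))) S κ₀ U x z a b| ≤ 2 * ((d : ℝ) + 1) * (E₀ / A) := by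
    have h := TripleFaceCharge.abs_divV_apply_le hM U x z a b
    rwa [hdiv, Pi.smul_apply, Pi.smul_apply, Pi.smul_apply, Pi.smul_apply, smul_eq_mul] at h
  -- units: `A · c = L^{2(d+1)}`
  have hc0 : (0 : ℝ) < ((Lc : ℝ) ^ ((d + 1) * (k + 1)))⁻¹ := by positivity
  rw [abs_mul, abs_of_pos hc0] at hent
  have eA : A * ((Lc : ℝ) ^ ((d + 1) * (k + 1)))⁻¹ = (((Lc ^ (k + 1) : ℕ) : ℝ)) ^ (2 * (d + 1)) := by
    rw [hA]; push_cast
    have hL0 : (Lc : ℝ) ^ ((d + 1) * (k + 1)) ≠ 0 := pow_ne_zero _ hLc.ne'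
    rw [← pow_mul, ← pow_mul, mul_inv_eq_iff_eq_mul₀ hL0, ← pow_add]
    congr 1; ring
  have h2 : A * ((((Lc : ℝ) ^ ((d + 1) * (k + 1)))⁻¹) * |push₃ T T (fun _ => gaugeWt (Lc ^ (k + 1))) S κ₀ U x z a b|) ≤ A * (2 * ((d : ℝ) + 1) * (E₀ / A)) :=
    mul_le_mul_of_nonneg_left hent hApos.le
  rw [← mul_assoc, eA] at h2
  calc _ ≤ A * (2 * ((d : ℝ) + 1) * (E₀ / A)) := h2
    _ = 2 * ((d : ℝ) + 1) * E₀ := by field_simp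

end Partial

end Summit.QuantumFields.BalabanUV.Beta.GAN24.GaugeReadTransport

end
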